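import Literature.Probability.LatticeModels.RandomClusterFiniteVolumePressure
import Literature.Probability.Percolation.BernoulliPercolation
import Mathlib.Algebra.BigOperators.Field
import HarnessLib

/-!
# FK-continuity cell, FO-10a: the wired cluster count is at most one plus the number of clusters avoiding the
# wired set — `k^B(ω) ≤ 1 + Σ_{x : C_x(ω) ∩ B = ∅} |C_x(ω)|⁻¹` (Grimmett 2006, proof of Thm. (4.58), wired side of (4.81)–(4.83))

Registered R89 (cell INBOX l.6394, 2026-08-24); registry row FO-10a-g338k; label KAP-D (coordinator fk-4 g195).
Cell `fk-continuity` (bschramm), row FO-10a; support file for the FK-continuity transplant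
(`--supports stmt-CriticalPhenomena-4575`); builds on p205010 (kernel theorem, internal audit signed;
external expert review pending). Pure proofs; no definitions, no named facts, no sorries.

On a finite vertex type: the connected components of `openGraph ω ⊔ wired B` are the images of the components of
`openGraph ω`; all components meeting `B` merge into one, the components avoiding `B` survive. Hence
`clusterCount ω B ≤ 1 + #{clusters of ω disjoint from B} = 1 + Σ_x 1{C_x(ω) ∩ B = ∅}·|C_x(ω)|⁻¹` (double counting).

## References
* G. Grimmett, *The Random-Cluster Model*, Springer 2006 (`book:grimmett2006-random-cluster-model`): §4.5,
  proof of Thm. (4.58), (4.81)–(4.83) [PDF p. 94]; §4.2 (4.12) (wired count). [Grimmett2006]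
-/

noncomputable section

open scoped Classical
open Finset

namespace Summit.CriticalPhenomena.PercolationContinuityZ3.Theorems.FK

open Literature.Probability.Percolation Literature.Probability.LatticeModels

variable {V : Type*} [Fintype V]

/-- Restricted double counting: for a graph `H` on a finite vertex type and a set `D` of components,
`Σ_x 1{comp(x) ∈ D} / |supp comp(x)| = #D`. [folklore] -/
theorem sum_ite_inv_ncard_supp_eq_card (H : SimpleGraph V) (D : Finset H.ConnectedComponent) :
    ∑ x : V, (if H.connectedComponentMk x ∈ D then (((H.connectedComponentMk x).supp.ncard : ℝ))⁻¹ else 0) = #D := by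
  classical
  rw [← Fintype.sum_fiberwise (fun x : V => H.connectedComponentMk x)
    (fun x : V => (if H.connectedComponentMk x ∈ D then (((H.connectedComponentMk x).supp.ncard : ℝ))⁻¹ else 0))]
  rw [Finset.card_eq_sum_ones, Nat.cast_sum, Nat.cast_one, ← Finset.sum_filter_add_sum_filter_not Finset.univ (· ∈ D)]
  have hfil : Finset.univ.filter (fun c : H.ConnectedComponent => c ∈ D) = D := by
    ext c; simp
  rw [hfil, ← add_zero (∑ _ ∈ D, (1 : ℝ))]
  congr 1
  · refine Finset.sum_congr rfl fun c hc => ?_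
    have hsupp : ∀ y : {x : V // H.connectedComponentMk x = c}, H.connectedComponentMk y.1 = c := fun y => y.2
    simp_rw [hsupp, if_pos hc]
    rw [Finset.sum_const, nsmul_eq_mul, Finset.card_univ]
    have hcard : Fintype.card {x : V // H.connectedComponentMk x = c} = c.supp.ncard := by
      rw [Set.ncard_eq_toFinset_card', Fintype.card_subtype]
      congr 1
      ext x
      simp only [Finset.mem_filter, Finset.mem_univ, true_and, Set.mem_toFinset,
        SimpleGraph.ConnectedComponent.mem_supp_iff]
    have hpos : 0 < c.supp.ncard := by
      induction c using SimpleGraph.ConnectedComponent.ind with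
      | h v =>
        rw [Set.ncard_pos (Set.toFinite _)]
        exact ⟨v, rfl⟩
    rw [hcard, mul_inv_cancel₀]
    exact_mod_cast hpos.ne'
  · refine Finset.sum_eq_zero fun c hc => ?_
    rw [Finset.mem_filter] at hc
    refine Finset.sum_eq_zero fun y _ => ?_
    rw [y.2, if_neg hc.2]

/-- **Components of `G ⊔ wired B`: at most one more than the components of `G` avoiding `B`.** [folklore] -/
theorem natCard_connectedComponent_sup_wired_le (G : SimpleGraph V) (B : Set V) :
    (Nat.card (G ⊔ wired B).ConnectedComponent : ℝ) ≤
      1 + ∑ x : V, (if Disjoint ((G.connectedComponentMk x).supp) B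
        then (((G.connectedComponentMk x).supp.ncard : ℝ))⁻¹ else 0) := by
  classical
  set H := G ⊔ wired B with hH
  -- the comparison map on components
  set φ : G.ConnectedComponent → H.ConnectedComponent :=
    SimpleGraph.ConnectedComponent.map (SimpleGraph.Hom.ofLE (le_sup_left : G ≤ H)) with hφ
  have hφmk : ∀ x : V, φ (G.connectedComponentMk x) = H.connectedComponentMk x := fun x => rfl
  have hsurj : Function.Surjective φ := by
    intro c
    induction c using SimpleGraph.ConnectedComponent.ind with
    | h v => exact ⟨G.connectedComponentMk v, hφmk v⟩
  -- the components avoiding `B`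
  set D : Finset G.ConnectedComponent := Finset.univ.filter fun c => Disjoint c.supp B with hD
  -- all components meeting `B` have the same image
  have hmeet : ∀ c c' : G.ConnectedComponent, ¬ Disjoint c.supp B → ¬ Disjoint c'.supp B → φ c = φ c' := by
    intro c c' hc hc'
    obtain ⟨b, hbc, hbB⟩ := Set.not_disjoint_iff.1 hc
    obtain ⟨b', hb'c, hb'B⟩ := Set.not_disjoint_iff.1 hc'
    rw [SimpleGraph.ConnectedComponent.mem_supp_iff] at hbc hb'c
    rw [← hbc, ← hb'c, hφmk, hφmk, SimpleGraph.ConnectedComponent.eq]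
    by_cases hbb : b = b'
    · exact hbb ▸ SimpleGraph.Reachable.refl _
    · exact SimpleGraph.Adj.reachable (by
        rw [hH, SimpleGraph.sup_adj, wired_adj]
        exact Or.inr ⟨hbb, hbB, hb'B⟩)
  -- count: `univ = φ '' D ∪ φ '' Dᶜ`, the second image has at most one element
  have hcover : (Finset.univ : Finset H.ConnectedComponent) ⊆ D.image φ ∪ (Dᶜ).image φ := by
    intro c _
    obtain ⟨c₀, rfl⟩ := hsurj c
    by_cases h : c₀ ∈ D
    · exact Finset.mem_union_left _ (Finset.mem_image_of_mem φ h)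
    · exact Finset.mem_union_right _ (Finset.mem_image_of_mem φ (Finset.mem_compl.2 h))
  have hsub1 : #((Dᶜ).image φ) ≤ 1 := by
    rw [Finset.card_le_one]
    intro a ha b hb
    rw [Finset.mem_image] at ha hb
    obtain ⟨c, hc, rfl⟩ := ha
    obtain ⟨c', hc', rfl⟩ := hb
    rw [hD, Finset.mem_compl, Finset.mem_filter, not_and] at hc hc'
    exact hmeet c c' (hc (Finset.mem_univ _)) (hc' (Finset.mem_univ _))
  have hcard : Nat.card H.ConnectedComponent ≤ 1 + #D := by
    rw [Nat.card_eq_fintype_card, ← Finset.card_univ]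
    calc #(Finset.univ : Finset H.ConnectedComponent) ≤ #(D.image φ ∪ (Dᶜ).image φ) := Finset.card_le_card hcover
      _ ≤ #(D.image φ) + #((Dᶜ).image φ) := Finset.card_union_le _ _
      _ ≤ #D + 1 := add_le_add Finset.card_image_le hsub1
      _ = 1 + #D := add_comm _ _
  have hsum := sum_ite_inv_ncard_supp_eq_card G D
  have hite : ∀ x : V, (if G.connectedComponentMk x ∈ D then (((G.connectedComponentMk x).supp.ncard : ℝ))⁻¹ else 0) =
      (if Disjoint ((G.connectedComponentMk x).supp) B then (((G.connectedComponentMk x).supp.ncard : ℝ))⁻¹ else 0) := by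
    intro x
    simp only [hD, Finset.mem_filter, Finset.mem_univ, true_and]
  simp_rw [hite] at hsum
  rw [hsum]
  exact_mod_cast hcard

/-- **`k^B(ω) ≤ 1 + Σ_x 1{C_x(ω) ∩ B = ∅}·|C_x(ω)|⁻¹`** on a finite vertex type: wiring `B` merges the clusters meeting
`B` into one and leaves the clusters avoiding `B` untouched. [cite: Grimmett2006, §4.2 (4.12) and proof of Thm. (4.58)] -/
theorem clusterCount_le_one_add_sum_ite_inv_ncard (ω : BondConfig V) (B : Set V) :
    (clusterCount ω B : ℝ) ≤
      1 + ∑ x : V, (if Disjoint (openCluster ω x) B then (((openCluster ω x).ncard : ℝ))⁻¹ else 0) := by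
  have h := natCard_connectedComponent_sup_wired_le (openGraph ω) B
  simp_rw [← openCluster_eq_supp] at h
  exact h

end Summit.CriticalPhenomena.PercolationContinuityZ3.Theorems.FK

end
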